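import Summits.QuantumAdvantage.QuantumAdvantage.Theorems.AvgFaceBeyondPrior.Negative.AvgFaceBeyondPriorNecessary
import Summits.QuantumAdvantage.QuantumAdvantage.Theorems.AvgFaceBeyondPrior.Negative.AvgFaceBeyondPriorBlocks
import Summits.QuantumAdvantage.QuantumAdvantage.Theorems.AvgFaceBeyondPrior.Negative.AvgFaceBeyondPriorOften

/-!
# Line `arith-complexity-split` — crux stmt-QuantumAdvantage-2427 (`ArithStatLadder.AvgFaceBeyondPrior`)

Skeleton registered by the crux-strategist (wall-breaker seat planner-cstrat-stmt-QuantumAdvantage-2427-p1-0,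
2026-08-17; card `Lines/arith-complexity-split.md`; census `STRATEGY-CENSUS.md`). It is the DECOMPOSITION of the crux
at the arithmetic × complexity joint, written as a line because `route edit --split` is offered to seats on their final
cycle only (the identical split is ready as `children.json`, see the card):

* `stub_densityFloor`   — ARITHMETIC STATISTICS (open; necessary up to its margin: `Negative.avgFace_imp_exists_level_ge`):
  for some `η > 0`, beyond every level there is a block with `#{3 ∣ h(−d)} ≥ (1/3 + η)·#𝒟ₙ`.
* `stub_densityCeiling` — DAVENPORT–HEILBRONN (printed; `= DeltaCeiling.card_three_dvd_le_of_dh` modulo the named fact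
  `bst_threeTorsion_mean`): eventually `#{3 ∣ h} ≤ (1/2 + ε)·#𝒟ₙ`.
* `stub_priorOptimal`   — COMPUTATIONAL COHEN–LENSTRA (hypothesis-type, held by the lead, refuters first): no PPT `A(x,1ⁿ)`
  has eventually fewer bad inputs (coin error `≥ 1/4`, the crux's event) than the better constant predictor minus `η·#𝒟ₙ`.
* `AvgFaceBeyondPrior_of` — the composition, a REAL proof (no sorry) concluding the route decl by name.
* `floor_of_dhLower_of_tail` — PROVED tooling for stub 1: the Davenport–Heilbronn LOWER block mean together with the
  linear TAIL bound `Σ_{r₃ ≥ 2} 3^{r₃} ≤ (1/3 − κ)·#𝒟ₙ` (infinitely often) give the floor with `η = κ/4` — the cheapest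
  arithmetic road known to this seat (the second-moment road `M₂ < 23/3` via the LP of TriageK2-LPLemma.lean is the other).

Each stub is WEAKER than the conjunction of dead-line stubs it replaces (`stub_secondMomentBelow ∧ stub_dhMeanImaginary ⇒`
floor; `stub_noPPTConcentration ∧ stub_dhMeanImaginary ⇒` prior-optimality; converses fail), and no stub is the crux or the
binder in disguise (four must-fail probes in the census §5.2). Separation strength (crux ⇒ `IQ3 ∉ BPP` ⇒ `NP ⊄ BPP`) is
carried JOINTLY by stubs 1 ∧ 3 and by neither alone (positive proportion of `3 ∣ h(−d)` is open).
-/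

set_option linter.dupNamespace false

noncomputable section

namespace Summit.QuantumAdvantage.QuantumAdvantage.Cruxes.AvgFaceBeyondPrior.ArithComplexitySplit

open Filter Finset
open scoped Classical
open _root_.Computability Literature.Computability.Complexity Literature.Computability.MetaComplexity
open Literature.NumberTheory.QuadraticFields
open Summit.QuantumAdvantage.QuantumAdvantage.Theorems.AvgFaceBeyondPrior
open Summit.QuantumAdvantage.QuantumAdvantage.Theses.ArithStatLadder

/-! ## Registered stubs -/

/-- **stub 1 (arithmetic statistics, XL, OPEN)** — the density floor of `3 ∣ h(−d)` above `1/3`, infinitely often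
with a fixed margin. Cohen–Lenstra: `→ 0.43987`. In print: not even a positive proportion (Nagell; Soundararajan 2000;
Heath-Brown 2007). Roads: `floor_of_dhLower_of_tail` below (DH lower mean + linear tail bound), or the moment LP with
any second moment `M₂ < 23/3`. [cite: CohenLenstra1984, §9 (C2)] -/
theorem stub_densityFloor :
    ∃ η : ℝ, 0 < η ∧ ∀ N : ℕ, ∃ n : ℕ, N ≤ n ∧ (1 / 3 + η) * (((Finset.Ico (2 ^ (n - 1)) (2 ^ n)).filter (fun d : ℕ => (((-(d:ℤ)) % 4 = 1 ∧ Squarefree (-(d:ℤ)) ∧ (-(d:ℤ)) ≠ 1) ∨ (4 ∣ (-(d:ℤ)) ∧ ((-(d:ℤ)) / 4 % 4 = 2 ∨ (-(d:ℤ)) / 4 % 4 = 3) ∧ Squarefree ((-(d:ℤ)) / 4))))).card : ℝ) ≤ ((((Finset.Ico (2 ^ (n - 1)) (2 ^ n)).filter (fun d : ℕ => (((-(d:ℤ)) % 4 = 1 ∧ Squarefree (-(d:ℤ)) ∧ (-(d:ℤ)) ≠ 1) ∨ (4 ∣ (-(d:ℤ)) ∧ ((-(d:ℤ)) / 4 %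 4 = 2 ∨ (-(d:ℤ)) / 4 % 4 = 3) ∧ Squarefree ((-(d:ℤ)) / 4))))).filter (fun d : ℕ => 3 ∣ Literature.NumberTheory.QuadraticFields.BinaryQuadraticForm.classNumber (-(d:ℤ)))).card : ℝ) := by
  sorry

/-- **stub 2 (Davenport–Heilbronn ceiling, M; closes by `DeltaCeiling.card_three_dvd_le_of_dh h` the day the named
fact `h : bst_threeTorsion_mean` is discharged — `Negative.fundBlock n` is definitionally this literal finset)**.
[cite: DavenportHeilbronn1971, Thm 3] -/
theorem stub_densityCeiling :
    ∀ ε : ℝ, 0 < ε → ∀ᶠ n : ℕ in Filter.atTop, ((((Finset.Ico (2 ^ (n - 1)) (2 ^ n)).filter (fun d : ℕ => (((-(d:ℤ)) % 4 = 1 ∧ Squarefree (-(d:ℤ)) ∧ (-(d:ℤ)) ≠ 1) ∨ (4 ∣ (-(d:ℤ)) ∧ ((-(d:ℤ)) / 4 % 4 = 2 ∨ (-(d:ℤ)) / 4 % 4 = 3) ∧ Squarefree ((-(d:ℤ)) / 4))))).filter (fun d : ℕ => 3 ∣ Literature.NumberTheory.QuadraticFields.BinaryQuadraticForm.classNumber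 (-(d:ℤ)))).card : ℝ) ≤ (1 / 2 + ε) * (((Finset.Ico (2 ^ (n - 1)) (2 ^ n)).filter (fun d : ℕ => (((-(d:ℤ)) % 4 = 1 ∧ Squarefree (-(d:ℤ)) ∧ (-(d:ℤ)) ≠ 1) ∨ (4 ∣ (-(d:ℤ)) ∧ ((-(d:ℤ)) / 4 % 4 = 2 ∨ (-(d:ℤ)) / 4 % 4 = 3) ∧ Squarefree ((-(d:ℤ)) / 4))))).card : ℝ) := by
  sorry

/-- **stub 3 (computational Cohen–Lenstra; HYPOTHESIS-TYPE — held by the lead, never delegated, refuters first)**: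
prior-optimality of every PPT predictor, for every margin, eventually. Met with slack `0` by the constant predictors
(`Split.priorOptimal_constFalse`); its restriction to predictors through finitely many local conditions follows from
first moments (Bhargava–Varma 2016 Thm 1 + Markov). Alone NOT known to imply `IQ3 ∉ BPP`.
[cite: BogdanovTrevisan2006, Def. 2.13] [cite: CohenLenstra1984, §9 (C2)] -/
theorem stub_priorOptimal :
    ∀ A : Literature.Computability.Complexity.RandAlg (List Bool × ℕ) Bool, A.IsPolyTime Literature.Computability.MetaComplexity.paramEnc Computability.encodeBool → ∀ η : ℝ, 0 < η → ∀ᶠ n : ℕ in Filter.atTop, min ((((Finset.Ico (2 ^ (n - 1)) (2 ^ n)).filter (fun d : ℕ => (((-(d:ℤ)) % 4 = 1 ∧ Squarefree (-(d:ℤ)) ∧ (-(d:ℤ)) ≠ 1) ∨ (4 ∣ (-(d:ℤ)) ∧ ((-(d:ℤ)) / 4 % 4 = 2 ∨ (-(d:ℤ)) / 4 % 4 = 3) ∧ Squarefree ((-(d:ℤ)) / 4))))).filter (fun d : ℕ => 3 ∣ Literature.NumberTheory.QuadraticFields.BinaryQuadraticForm.classNumber (-(d:ℤ)))).card : ℝ)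 ((((Finset.Ico (2 ^ (n - 1)) (2 ^ n)).filter (fun d : ℕ => (((-(d:ℤ)) % 4 = 1 ∧ Squarefree (-(d:ℤ)) ∧ (-(d:ℤ)) ≠ 1) ∨ (4 ∣ (-(d:ℤ)) ∧ ((-(d:ℤ)) / 4 % 4 = 2 ∨ (-(d:ℤ)) / 4 % 4 = 3) ∧ Squarefree ((-(d:ℤ)) / 4))))).card : ℝ) - ((((Finset.Ico (2 ^ (n - 1)) (2 ^ n)).filter (fun d : ℕ => (((-(d:ℤ)) % 4 = 1 ∧ Squarefree (-(d:ℤ)) ∧ (-(d:ℤ)) ≠ 1) ∨ (4 ∣ (-(d:ℤ)) ∧ ((-(d:ℤ)) / 4 % 4 = 2 ∨ (-(d:ℤ)) / 4 % 4 = 3) ∧ Squarefree ((-(d:ℤ)) / 4))))).filter (fun d : ℕ => 3 ∣ Literature.NumberTheory.QuadraticFields.BinaryQuadraticForm.classNumber (-(d:ℤ)))).card : ℝ)) - η * (((Finset.Ico (2 ^ (n - 1)) (2 ^ n)).filter (fun d : ℕ => (((-(d:ℤ)) % 4 = 1 ∧ Squarefree (-(d:ℤ)) ∧ (-(d:ℤ))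 ≠ 1) ∨ (4 ∣ (-(d:ℤ)) ∧ ((-(d:ℤ)) / 4 % 4 = 2 ∨ (-(d:ℤ)) / 4 % 4 = 3) ∧ Squarefree ((-(d:ℤ)) / 4))))).card : ℝ) ≤ ((((Finset.Ico (2 ^ (n - 1)) (2 ^ n)).filter (fun d : ℕ => (((-(d:ℤ)) % 4 = 1 ∧ Squarefree (-(d:ℤ)) ∧ (-(d:ℤ)) ≠ 1) ∨ (4 ∣ (-(d:ℤ)) ∧ ((-(d:ℤ)) / 4 % 4 = 2 ∨ (-(d:ℤ)) / 4 % 4 = 3) ∧ Squarefree ((-(d:ℤ)) / 4))))).filter (fun d : ℕ => (1 : ℝ) / 4 ≤ A.pr Literature.Computability.MetaComplexity.paramEnc (Computability.encodeNat d, n) {b : Bool | b ≠ (Computability.encodingNatBool.toLanguage {d : ℕ | (((-(d:ℤ)) % 4 = 1 ∧ Squarefree (-(d:ℤ)) ∧ (-(d:ℤ)) ≠ 1) ∨ (4 ∣ (-(d:ℤ)) ∧ ((-(d:ℤ)) / 4 % 4 = 2 ∨ (-(d:ℤ)) / 4 % 4 = 3) ∧ Squarefree ((-(d:ℤ)) /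 4))) ∧ 3 ∣ Literature.NumberTheory.QuadraticFields.BinaryQuadraticForm.classNumber (-(d:ℤ))}).boolIndicator (Computability.encodeNat d)})).card : ℝ) := by
  sorry

/-! ## The composition (real proof) -/

/-- **The line closes the crux**: floor ∧ ceiling ∧ prior-optimality ⇒ `AvgFaceBeyondPrior` (by name).
`θ = min η 1/12`; eventually prior-optimality at `θ/2` and the ceiling at `1/12`; at a floor level `n ≥ 2` beyond that,
`#bad ≥ (1/3 + θ)·#𝒟ₙ − (θ/2)·#𝒟ₙ > #𝒟ₙ/3`, i.e. bad mass `> 1/3` (`Negative.ens_prob_eq`) = the crux unfolded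
(`Negative.avgFace_iff`). Same proof as `Split.AvgFaceBeyondPrior_of_subs` (Cruxes/AvgFaceBeyondPrior/Split.lean).
[cite: BogdanovTrevisan2006, Def. 2.13] -/
theorem AvgFaceBeyondPrior_of
    (hFloor : ∃ η : ℝ, 0 < η ∧ ∀ N : ℕ, ∃ n : ℕ, N ≤ n ∧ (1 / 3 + η) * (((Finset.Ico (2 ^ (n - 1)) (2 ^ n)).filter (fun d : ℕ => (((-(d:ℤ)) % 4 = 1 ∧ Squarefree (-(d:ℤ)) ∧ (-(d:ℤ)) ≠ 1) ∨ (4 ∣ (-(d:ℤ)) ∧ ((-(d:ℤ)) / 4 % 4 = 2 ∨ (-(d:ℤ)) / 4 % 4 = 3) ∧ Squarefree ((-(d:ℤ)) / 4))))).card : ℝ) ≤ ((((Finset.Ico (2 ^ (n - 1)) (2 ^ n)).filter (fun d : ℕ => (((-(d:ℤ)) % 4 = 1 ∧ Squarefree (-(d:ℤ)) ∧ (-(d:ℤ)) ≠ 1) ∨ (4 ∣ (-(d:ℤ)) ∧ ((-(d:ℤ)) / 4 % 4 = 2 ∨ (-(d:ℤ)) / 4 % 4 = 3) ∧ Squarefree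 ((-(d:ℤ)) / 4))))).filter (fun d : ℕ => 3 ∣ Literature.NumberTheory.QuadraticFields.BinaryQuadraticForm.classNumber (-(d:ℤ)))).card : ℝ))
    (hCeil : ∀ ε : ℝ, 0 < ε → ∀ᶠ n : ℕ in Filter.atTop, ((((Finset.Ico (2 ^ (n - 1)) (2 ^ n)).filter (fun d : ℕ => (((-(d:ℤ)) % 4 = 1 ∧ Squarefree (-(d:ℤ)) ∧ (-(d:ℤ)) ≠ 1) ∨ (4 ∣ (-(d:ℤ)) ∧ ((-(d:ℤ)) / 4 % 4 = 2 ∨ (-(d:ℤ)) / 4 % 4 = 3) ∧ Squarefree ((-(d:ℤ)) / 4))))).filter (fun d : ℕ => 3 ∣ Literature.NumberTheory.QuadraticFields.BinaryQuadraticForm.classNumber (-(d:ℤ)))).card : ℝ) ≤ (1 / 2 + ε) * (((Finset.Ico (2 ^ (n - 1)) (2 ^ n)).filter (fun d : ℕ => (((-(d:ℤ)) % 4 = 1 ∧ Squarefree (-(d:ℤ)) ∧ (-(d:ℤ)) ≠ 1) ∨ (4 ∣ (-(d:ℤ)) ∧ ((-(d:ℤ)) / 4 % 4 = 2 ∨ (-(d:ℤ))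 / 4 % 4 = 3) ∧ Squarefree ((-(d:ℤ)) / 4))))).card : ℝ))
    (hPrior : ∀ A : Literature.Computability.Complexity.RandAlg (List Bool × ℕ) Bool, A.IsPolyTime Literature.Computability.MetaComplexity.paramEnc Computability.encodeBool → ∀ η : ℝ, 0 < η → ∀ᶠ n : ℕ in Filter.atTop, min ((((Finset.Ico (2 ^ (n - 1)) (2 ^ n)).filter (fun d : ℕ => (((-(d:ℤ)) % 4 = 1 ∧ Squarefree (-(d:ℤ)) ∧ (-(d:ℤ)) ≠ 1) ∨ (4 ∣ (-(d:ℤ)) ∧ ((-(d:ℤ)) / 4 % 4 = 2 ∨ (-(d:ℤ)) / 4 % 4 = 3) ∧ Squarefree ((-(d:ℤ)) / 4))))).filter (fun d : ℕ => 3 ∣ Literature.NumberTheory.QuadraticFields.BinaryQuadraticForm.classNumber (-(d:ℤ)))).card : ℝ) ((((Finset.Ico (2 ^ (n - 1)) (2 ^ n)).filter (fun d : ℕ => (((-(d:ℤ)) % 4 = 1 ∧ Squarefree (-(d:ℤ)) ∧ (-(d:ℤ)) ≠ 1) ∨ (4 ∣ (-(d:ℤ)) ∧ ((-(d:ℤ))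 / 4 % 4 = 2 ∨ (-(d:ℤ)) / 4 % 4 = 3) ∧ Squarefree ((-(d:ℤ)) / 4))))).card : ℝ) - ((((Finset.Ico (2 ^ (n - 1)) (2 ^ n)).filter (fun d : ℕ => (((-(d:ℤ)) % 4 = 1 ∧ Squarefree (-(d:ℤ)) ∧ (-(d:ℤ)) ≠ 1) ∨ (4 ∣ (-(d:ℤ)) ∧ ((-(d:ℤ)) / 4 % 4 = 2 ∨ (-(d:ℤ)) / 4 % 4 = 3) ∧ Squarefree ((-(d:ℤ)) / 4))))).filter (fun d : ℕ => 3 ∣ Literature.NumberTheory.QuadraticFields.BinaryQuadraticForm.classNumber (-(d:ℤ)))).card : ℝ)) - η * (((Finset.Ico (2 ^ (n - 1)) (2 ^ n)).filter (fun d : ℕ => (((-(d:ℤ)) % 4 = 1 ∧ Squarefree (-(d:ℤ)) ∧ (-(d:ℤ)) ≠ 1) ∨ (4 ∣ (-(d:ℤ)) ∧ ((-(d:ℤ)) / 4 % 4 = 2 ∨ (-(d:ℤ)) / 4 % 4 = 3) ∧ Squarefree ((-(d:ℤ)) / 4))))).card : ℝ) ≤ ((((Finset.Ico (2 ^ (n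 - 1)) (2 ^ n)).filter (fun d : ℕ => (((-(d:ℤ)) % 4 = 1 ∧ Squarefree (-(d:ℤ)) ∧ (-(d:ℤ)) ≠ 1) ∨ (4 ∣ (-(d:ℤ)) ∧ ((-(d:ℤ)) / 4 % 4 = 2 ∨ (-(d:ℤ)) / 4 % 4 = 3) ∧ Squarefree ((-(d:ℤ)) / 4))))).filter (fun d : ℕ => (1 : ℝ) / 4 ≤ A.pr Literature.Computability.MetaComplexity.paramEnc (Computability.encodeNat d, n) {b : Bool | b ≠ (Computability.encodingNatBool.toLanguage {d : ℕ | (((-(d:ℤ)) % 4 = 1 ∧ Squarefree (-(d:ℤ)) ∧ (-(d:ℤ)) ≠ 1) ∨ (4 ∣ (-(d:ℤ)) ∧ ((-(d:ℤ)) / 4 % 4 = 2 ∨ (-(d:ℤ)) / 4 % 4 = 3) ∧ Squarefree ((-(d:ℤ)) / 4))) ∧ 3 ∣ Literature.NumberTheory.QuadraticFields.BinaryQuadraticForm.classNumber (-(d:ℤ))}).boolIndicator (Computability.encodeNat d)})).card : ℝ)) :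
    Summit.QuantumAdvantage.QuantumAdvantage.Theses.ArithStatLadder.AvgFaceBeyondPrior := by
  rw [Negative.avgFace_iff]
  intro A hA
  obtain ⟨η, hη, hFreq⟩ := hFloor
  set θ : ℝ := min η (1 / 12) with hθdef
  have hθpos : 0 < θ := lt_min hη (by norm_num)
  have hθη : θ ≤ η := min_le_left _ _
  have hθ12 : θ ≤ 1 / 12 := min_le_right _ _
  have hP := hPrior A hA (θ / 2) (by positivity)
  have hC := hCeil (1 / 12) (by norm_num)
  obtain ⟨N, hN⟩ := Filter.eventually_atTop.1 (hP.and hC)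
  obtain ⟨n, hn, hfl⟩ := hFreq (max N 2)
  have hn2 : 2 ≤ n := le_trans (le_max_right _ _) hn
  have hnN : N ≤ n := le_trans (le_max_left _ _) hn
  obtain ⟨hPn, hCn⟩ := hN n hnN
  have hne : (Negative.fundBlock n).Nonempty := Negative.Blocks.fundBlock_nonempty hn2
  refine ⟨n, ?_⟩
  rw [Negative.ens_prob_eq hne]
  have hcard : (0:ℝ) < (Negative.fundBlock n).card := by exact_mod_cast hne.card_pos
  rw [lt_div_iff₀ hcard]
  have hsub : (((Finset.Ico (2 ^ (n - 1)) (2 ^ n)).filter (fun d : ℕ => (((-(d:ℤ)) % 4 = 1 ∧ Squarefree (-(d:ℤ)) ∧ (-(d:ℤ)) ≠ 1) ∨ (4 ∣ (-(d:ℤ)) ∧ ((-(d:ℤ)) / 4 % 4 = 2 ∨ (-(d:ℤ)) / 4 % 4 = 3) ∧ Squarefree ((-(d:ℤ)) / 4))))).filter (fun d : ℕ => (1 : ℝ) / 4 ≤ A.pr Literature.Computability.MetaComplexity.paramEnc (Computability.encodeNat d, n) {b : Bool | b ≠ (Computability.encodingNatBool.toLanguage {d : ℕ | (((-(d:ℤ))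 % 4 = 1 ∧ Squarefree (-(d:ℤ)) ∧ (-(d:ℤ)) ≠ 1) ∨ (4 ∣ (-(d:ℤ)) ∧ ((-(d:ℤ)) / 4 % 4 = 2 ∨ (-(d:ℤ)) / 4 % 4 = 3) ∧ Squarefree ((-(d:ℤ)) / 4))) ∧ 3 ∣ Literature.NumberTheory.QuadraticFields.BinaryQuadraticForm.classNumber (-(d:ℤ))}).boolIndicator (Computability.encodeNat d)})) ⊆
      ((Negative.fundBlock n).filter fun d => encodeNat d ∈
        {x | (1:ℝ) / 4 ≤ A.pr paramEnc (x, n) {b | b ≠ Negative.iq3Lang.boolIndicator x}}) := by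
    intro d hd
    rw [Finset.mem_filter] at hd ⊢
    exact ⟨hd.1, hd.2⟩
  have hle' : ((((Finset.Ico (2 ^ (n - 1)) (2 ^ n)).filter (fun d : ℕ => (((-(d:ℤ)) % 4 = 1 ∧ Squarefree (-(d:ℤ)) ∧ (-(d:ℤ)) ≠ 1) ∨ (4 ∣ (-(d:ℤ)) ∧ ((-(d:ℤ)) / 4 % 4 = 2 ∨ (-(d:ℤ)) / 4 % 4 = 3) ∧ Squarefree ((-(d:ℤ)) / 4))))).filter (fun d : ℕ => (1 : ℝ) / 4 ≤ A.pr Literature.Computability.MetaComplexity.paramEnc (Computability.encodeNat d, n) {b : Bool | b ≠ (Computability.encodingNatBool.toLanguage {d : ℕ | (((-(d:ℤ)) % 4 = 1 ∧ Squarefree (-(d:ℤ)) ∧ (-(d:ℤ)) ≠ 1) ∨ (4 ∣ (-(d:ℤ)) ∧ ((-(d:ℤ)) / 4 % 4 = 2 ∨ (-(d:ℤ)) / 4 % 4 = 3) ∧ Squarefree ((-(d:ℤ)) / 4))) ∧ 3 ∣ Literature.NumberTheory.QuadraticFields.BinaryQuadraticForm.classNumber (-(d:ℤ))}).boolIndicator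 (Computability.encodeNat d)})).card : ℝ) ≤
      ((((Negative.fundBlock n).filter fun d => encodeNat d ∈
        {x | (1:ℝ) / 4 ≤ A.pr paramEnc (x, n) {b | b ≠ Negative.iq3Lang.boolIndicator x}}).card : ℝ)) := by
    exact_mod_cast Finset.card_le_card hsub
  have hDeq : ((Negative.fundBlock n).card : ℝ) = (((Finset.Ico (2 ^ (n - 1)) (2 ^ n)).filter (fun d : ℕ => (((-(d:ℤ)) % 4 = 1 ∧ Squarefree (-(d:ℤ)) ∧ (-(d:ℤ)) ≠ 1) ∨ (4 ∣ (-(d:ℤ)) ∧ ((-(d:ℤ)) / 4 % 4 = 2 ∨ (-(d:ℤ)) / 4 % 4 = 3) ∧ Squarefree ((-(d:ℤ)) / 4))))).card : ℝ) := rfl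
  rw [hDeq] at hcard ⊢
  set D : ℝ := (((Finset.Ico (2 ^ (n - 1)) (2 ^ n)).filter (fun d : ℕ => (((-(d:ℤ)) % 4 = 1 ∧ Squarefree (-(d:ℤ)) ∧ (-(d:ℤ)) ≠ 1) ∨ (4 ∣ (-(d:ℤ)) ∧ ((-(d:ℤ)) / 4 % 4 = 2 ∨ (-(d:ℤ)) / 4 % 4 = 3) ∧ Squarefree ((-(d:ℤ)) / 4))))).card : ℝ) with hDdef
  set T : ℝ := ((((Finset.Ico (2 ^ (n - 1)) (2 ^ n)).filter (fun d : ℕ => (((-(d:ℤ)) % 4 = 1 ∧ Squarefree (-(d:ℤ)) ∧ (-(d:ℤ)) ≠ 1) ∨ (4 ∣ (-(d:ℤ)) ∧ ((-(d:ℤ)) / 4 % 4 = 2 ∨ (-(d:ℤ)) / 4 % 4 = 3) ∧ Squarefree ((-(d:ℤ)) / 4))))).filter (fun d : ℕ => 3 ∣ Literature.NumberTheory.QuadraticFields.BinaryQuadraticForm.classNumber (-(d:ℤ)))).card : ℝ) with hTdef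
  have hT1 : (1 / 3 + θ) * D ≤ T := by
    have : (1 / 3 + θ) * D ≤ (1 / 3 + η) * D := by nlinarith
    exact this.trans hfl
  have hT2 : (1 / 3 + θ) * D ≤ D - T := by nlinarith
  have hmin : (1 / 3 + θ) * D ≤ min T (D - T) := le_min hT1 hT2
  have hbad : (1 / 3 + θ / 2) * D ≤ min T (D - T) - θ / 2 * D := by nlinarith
  have hfinal := (hbad.trans hPn).trans hle'
  have hlt : 1 / 3 * D < (1 / 3 + θ / 2) * D := by nlinarith
  exact lt_of_lt_of_le hlt hfinal

/-- The crux from the three stubs, by the composition (one line; closed=True once the stubs are). -/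
theorem avgFaceBeyondPrior_holds_of_stubs :
    Summit.QuantumAdvantage.QuantumAdvantage.Theses.ArithStatLadder.AvgFaceBeyondPrior :=
  AvgFaceBeyondPrior_of stub_densityFloor stub_densityCeiling stub_priorOptimal

/-! ## Proved tooling for stub 1: the floor from the DH lower block mean and a linear tail bound -/

/-- On the block, `3 ∣ h(−d) ↔ 1 < #Cl₃(−d)` (`three_dvd_classNumber_iff_one_lt_quadFieldThreeTorsion`: form class
number `= h(ℚ(√−d))`, Cauchy), so the two filters agree (literal-block copy of `DeltaCeiling.filter_three_dvd_eq`, kept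
import-free so that this file elaborates in the route file's own instance context). [folklore] -/
theorem filter_three_dvd_eq_lit (n : ℕ) :
    (((Finset.Ico (2 ^ (n - 1)) (2 ^ n)).filter (fun d : ℕ => (((-(d:ℤ)) % 4 = 1 ∧ Squarefree (-(d:ℤ)) ∧ (-(d:ℤ)) ≠ 1) ∨ (4 ∣ (-(d:ℤ)) ∧ ((-(d:ℤ)) / 4 % 4 = 2 ∨ (-(d:ℤ)) / 4 % 4 = 3) ∧ Squarefree ((-(d:ℤ)) / 4))))).filter (fun d : ℕ => 3 ∣ Literature.NumberTheory.QuadraticFields.BinaryQuadraticForm.classNumber (-(d:ℤ)))) =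
      (((Finset.Ico (2 ^ (n - 1)) (2 ^ n)).filter (fun d : ℕ => (((-(d:ℤ)) % 4 = 1 ∧ Squarefree (-(d:ℤ)) ∧ (-(d:ℤ)) ≠ 1) ∨ (4 ∣ (-(d:ℤ)) ∧ ((-(d:ℤ)) / 4 % 4 = 2 ∨ (-(d:ℤ)) / 4 % 4 = 3) ∧ Squarefree ((-(d:ℤ)) / 4))))).filter (fun d : ℕ => 1 < quadFieldThreeTorsion (-(d:ℤ)))) := by
  refine Finset.filter_congr fun d hd => ?_
  have hd' := (Finset.mem_filter).1 hd
  have hIco := Finset.mem_Ico.1 hd'.1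
  have hpos : 0 < d := lt_of_lt_of_le (Nat.two_pow_pos (n - 1)) hIco.1
  exact three_dvd_classNumber_iff_one_lt_quadFieldThreeTorsion hd'.2 (by omega)

/-- Pointwise: `t ≤ 1 + 2·𝟙[1 < t] + t·𝟙[9 ≤ t]` for `t = #Cl₃(−d) ∈ {1, 3, 9, 27, …}`. [folklore] -/
theorem torsion_le_one_add (d : ℕ) :
    (quadFieldThreeTorsion (-(d:ℤ)) : ℝ) ≤
      1 + 2 * (if 1 < quadFieldThreeTorsion (-(d:ℤ)) then (1:ℝ) else 0)
        + (if 9 ≤ quadFieldThreeTorsion (-(d:ℤ)) then (quadFieldThreeTorsion (-(d:ℤ)) : ℝ) else 0) := by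
  obtain ⟨r, hr⟩ := exists_quadFieldThreeTorsion_eq_pow (-(d:ℤ))
  rw [hr]
  rcases r with _ | _ | r
  · norm_num
  · norm_num
  · have h9 : 9 ≤ 3 ^ (r + 2) := by
      have : 3 ^ 2 ≤ 3 ^ (r + 2) := Nat.pow_le_pow_right (by norm_num) (by omega)
      simpa using this
    have h1 : 1 < 3 ^ (r + 2) := lt_of_lt_of_le (by norm_num) h9
    rw [if_pos h1, if_pos h9]
    linarith

/-- **Floor from DH-lower + tail** (PROVED): if the block mean of `#Cl₃(−d)` is eventually `≥ 2 − ε` for every `ε`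
(Davenport–Heilbronn, lower half) and, for some `κ > 0`, infinitely often the `3^{r₃}`-mass of the fields with
`r₃ ≥ 2` is at most `(1/3 − κ)·#𝒟ₙ`, then the floor holds with margin `κ/4`. (Cohen–Lenstra: that mass tends to
`≈ 0.18 < 1/3`.) [cite: DavenportHeilbronn1971, Thm 3] [cite: CohenLenstra1984, §9 (C2)] -/
theorem floor_of_dhLower_of_tail
    (hDH : ∀ ε : ℝ, 0 < ε → ∀ᶠ n : ℕ in Filter.atTop, (2 - ε) * (((Finset.Ico (2 ^ (n - 1)) (2 ^ n)).filter (fun d : ℕ => (((-(d:ℤ)) % 4 = 1 ∧ Squarefree (-(d:ℤ)) ∧ (-(d:ℤ)) ≠ 1) ∨ (4 ∣ (-(d:ℤ)) ∧ ((-(d:ℤ)) / 4 % 4 = 2 ∨ (-(d:ℤ)) / 4 % 4 = 3) ∧ Squarefree ((-(d:ℤ)) / 4))))).card : ℝ) ≤ ∑ d ∈ ((Finset.Ico (2 ^ (n - 1)) (2 ^ n)).filter (fun d : ℕ => (((-(d:ℤ)) % 4 = 1 ∧ Squarefree (-(d:ℤ)) ∧ (-(d:ℤ)) ≠ 1) ∨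 (4 ∣ (-(d:ℤ)) ∧ ((-(d:ℤ)) / 4 % 4 = 2 ∨ (-(d:ℤ)) / 4 % 4 = 3) ∧ Squarefree ((-(d:ℤ)) / 4))))), (Literature.NumberTheory.QuadraticFields.quadFieldThreeTorsion (-(d:ℤ)) : ℝ))
    (hTail : ∃ κ : ℝ, 0 < κ ∧ ∀ N : ℕ, ∃ n : ℕ, N ≤ n ∧ (∑ d ∈ ((Finset.Ico (2 ^ (n - 1)) (2 ^ n)).filter (fun d : ℕ => (((-(d:ℤ)) % 4 = 1 ∧ Squarefree (-(d:ℤ)) ∧ (-(d:ℤ)) ≠ 1) ∨ (4 ∣ (-(d:ℤ)) ∧ ((-(d:ℤ)) / 4 % 4 = 2 ∨ (-(d:ℤ)) / 4 % 4 = 3) ∧ Squarefree ((-(d:ℤ)) / 4))))).filter (fun d : ℕ => 9 ≤ Literature.NumberTheory.QuadraticFields.quadFieldThreeTorsion (-(d:ℤ))), (Literature.NumberTheory.QuadraticFields.quadFieldThreeTorsion (-(d:ℤ)) : ℝ)) ≤ (1 / 3 - κ) * (((Finset.Ico (2 ^ (n - 1)) (2 ^ n)).filter (fun d : ℕ =>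 (((-(d:ℤ)) % 4 = 1 ∧ Squarefree (-(d:ℤ)) ∧ (-(d:ℤ)) ≠ 1) ∨ (4 ∣ (-(d:ℤ)) ∧ ((-(d:ℤ)) / 4 % 4 = 2 ∨ (-(d:ℤ)) / 4 % 4 = 3) ∧ Squarefree ((-(d:ℤ)) / 4))))).card : ℝ)) :
    ∃ η : ℝ, 0 < η ∧ ∀ N : ℕ, ∃ n : ℕ, N ≤ n ∧ (1 / 3 + η) * (((Finset.Ico (2 ^ (n - 1)) (2 ^ n)).filter (fun d : ℕ => (((-(d:ℤ)) % 4 = 1 ∧ Squarefree (-(d:ℤ)) ∧ (-(d:ℤ)) ≠ 1) ∨ (4 ∣ (-(d:ℤ)) ∧ ((-(d:ℤ)) / 4 % 4 = 2 ∨ (-(d:ℤ)) / 4 % 4 = 3) ∧ Squarefree ((-(d:ℤ)) / 4))))).card : ℝ) ≤ ((((Finset.Ico (2 ^ (n - 1)) (2 ^ n)).filter (fun d : ℕ => (((-(d:ℤ)) % 4 = 1 ∧ Squarefree (-(d:ℤ)) ∧ (-(d:ℤ)) ≠ 1) ∨ (4 ∣ (-(d:ℤ)) ∧ ((-(d:ℤ))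 / 4 % 4 = 2 ∨ (-(d:ℤ)) / 4 % 4 = 3) ∧ Squarefree ((-(d:ℤ)) / 4))))).filter (fun d : ℕ => 3 ∣ Literature.NumberTheory.QuadraticFields.BinaryQuadraticForm.classNumber (-(d:ℤ)))).card : ℝ) := by
  obtain ⟨κ, hκ, hT⟩ := hTail
  refine ⟨κ / 4, by positivity, fun N => ?_⟩
  obtain ⟨N₁, hN₁⟩ := Filter.eventually_atTop.1 (hDH (κ / 2) (by positivity))
  obtain ⟨n, hn, htail⟩ := hT (max N N₁)
  refine ⟨n, le_trans (le_max_left _ _) hn, ?_⟩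
  have hmean := hN₁ n (le_trans (le_max_right _ _) hn)
  -- sum the pointwise bound over the block
  have hsum : (∑ d ∈ ((Finset.Ico (2 ^ (n - 1)) (2 ^ n)).filter (fun d : ℕ => (((-(d:ℤ)) % 4 = 1 ∧ Squarefree (-(d:ℤ)) ∧ (-(d:ℤ)) ≠ 1) ∨ (4 ∣ (-(d:ℤ)) ∧ ((-(d:ℤ)) / 4 % 4 = 2 ∨ (-(d:ℤ)) / 4 % 4 = 3) ∧ Squarefree ((-(d:ℤ)) / 4))))), (quadFieldThreeTorsion (-(d:ℤ)) : ℝ)) ≤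
      (((Finset.Ico (2 ^ (n - 1)) (2 ^ n)).filter (fun d : ℕ => (((-(d:ℤ)) % 4 = 1 ∧ Squarefree (-(d:ℤ)) ∧ (-(d:ℤ)) ≠ 1) ∨ (4 ∣ (-(d:ℤ)) ∧ ((-(d:ℤ)) / 4 % 4 = 2 ∨ (-(d:ℤ)) / 4 % 4 = 3) ∧ Squarefree ((-(d:ℤ)) / 4))))).card : ℝ) + 2 * ((((Finset.Ico (2 ^ (n - 1)) (2 ^ n)).filter (fun d : ℕ => (((-(d:ℤ)) % 4 = 1 ∧ Squarefree (-(d:ℤ)) ∧ (-(d:ℤ)) ≠ 1) ∨ (4 ∣ (-(d:ℤ)) ∧ ((-(d:ℤ)) / 4 % 4 = 2 ∨ (-(d:ℤ)) / 4 % 4 = 3) ∧ Squarefree ((-(d:ℤ)) / 4))))).filter (fun d : ℕ => 1 < quadFieldThreeTorsion (-(d:ℤ)))).card : ℝ)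
        + ∑ d ∈ ((Finset.Ico (2 ^ (n - 1)) (2 ^ n)).filter (fun d : ℕ => (((-(d:ℤ)) % 4 = 1 ∧ Squarefree (-(d:ℤ)) ∧ (-(d:ℤ)) ≠ 1) ∨ (4 ∣ (-(d:ℤ)) ∧ ((-(d:ℤ)) / 4 % 4 = 2 ∨ (-(d:ℤ)) / 4 % 4 = 3) ∧ Squarefree ((-(d:ℤ)) / 4))))).filter (fun d : ℕ => 9 ≤ quadFieldThreeTorsion (-(d:ℤ))), (quadFieldThreeTorsion (-(d:ℤ)) : ℝ) := by
    have h := Finset.sum_le_sum (s := ((Finset.Ico (2 ^ (n - 1)) (2 ^ n)).filter (fun d : ℕ => (((-(d:ℤ)) % 4 = 1 ∧ Squarefree (-(d:ℤ)) ∧ (-(d:ℤ)) ≠ 1) ∨ (4 ∣ (-(d:ℤ)) ∧ ((-(d:ℤ)) / 4 % 4 = 2 ∨ (-(d:ℤ)) / 4 % 4 = 3) ∧ Squarefree ((-(d:ℤ)) / 4)))))) (fun d _ => torsion_le_one_add d)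
    rw [Finset.sum_add_distrib, Finset.sum_add_distrib, ← Finset.mul_sum, Finset.sum_boole, Finset.sum_const,
      nsmul_eq_mul, mul_one, ← Finset.sum_filter] at h
    simpa using h
  -- `3 ∣ h(−d) ↔ 1 < #Cl₃(−d)` on the block
  have hfilt : (((Finset.Ico (2 ^ (n - 1)) (2 ^ n)).filter (fun d : ℕ => (((-(d:ℤ)) % 4 = 1 ∧ Squarefree (-(d:ℤ)) ∧ (-(d:ℤ)) ≠ 1) ∨ (4 ∣ (-(d:ℤ)) ∧ ((-(d:ℤ)) / 4 % 4 = 2 ∨ (-(d:ℤ)) / 4 % 4 = 3) ∧ Squarefree ((-(d:ℤ)) / 4))))).filter (fun d : ℕ => 3 ∣ Literature.NumberTheory.QuadraticFields.BinaryQuadraticForm.classNumber (-(d:ℤ)))) =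
      (((Finset.Ico (2 ^ (n - 1)) (2 ^ n)).filter (fun d : ℕ => (((-(d:ℤ)) % 4 = 1 ∧ Squarefree (-(d:ℤ)) ∧ (-(d:ℤ)) ≠ 1) ∨ (4 ∣ (-(d:ℤ)) ∧ ((-(d:ℤ)) / 4 % 4 = 2 ∨ (-(d:ℤ)) / 4 % 4 = 3) ∧ Squarefree ((-(d:ℤ)) / 4))))).filter (fun d : ℕ => 1 < quadFieldThreeTorsion (-(d:ℤ)))) :=
    filter_three_dvd_eq_lit n
  rw [hfilt]
  nlinarith [hsum, hmean, htail]

end Summit.QuantumAdvantage.QuantumAdvantage.Cruxes.AvgFaceBeyondPrior.ArithComplexitySplit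

end
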